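import Literature.NumberTheory.Sieve.LinearEquationsInPrimesNormalFormProofs
import HarnessLib

/-!
# Odd-order logarithmic Chowla (Tao–Teräväinen 2018): the bilinear Gowers-uniformity input

Topic `Literature/NumberTheory/Sieve`.  Everything in this file is PROVED relative to the named fact
`Literature.NumberTheory.Sieve.GreenTao2010_gowersUniformityAt s` (Green–Tao 2010, Thm. 7.2 at level `s`,
`LinearEquationsInPrimesNormalForm.lean`), which enters as an explicit hypothesis; no definitions of
mathematical content beyond private bookkeeping, no new named facts.

This is the first step of the tree's formalisation of T. Tao, J. Teräväinen, *Odd order cases of the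
logarithmically averaged Chowla conjecture*, J. Théor. Nombres Bordeaux **30** (2018), 997–1015
(arXiv:1710.02112), towards the named fact
`Literature.NumberTheory.Sieve.liouville_logCorrelation_isLittleO_of_odd` (`ParityWave0.lean`, parity.S22).
Section 5 of the paper ("Using the Gowers norms") combines

* **Lemma 5.2** (a generalised von Neumann theorem, uniform in the modulus and the shifts):
  `|𝔼_{d ≤ N/W} 𝔼_{n ≤ N} θ(d) φ₁(a₁n + W b₁ d + r₁) ⋯ φ_k(a_k n + W b_k d + r_k)| ≤ C ‖θ‖_{U^k[N/W]} + o(1)`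
  for `1`-bounded `φⱼ`, and
* **Lemma 5.3** (Gowers uniformity of the `W`-tricked von Mangoldt function,
  `‖Λ_{b,W} - 1‖_{U^{k}[N]} = o_{w → ∞}(1)`, "proven in [Green–Tao, Linear equations in primes] subject to
  conjectures later verified in [Green–Tao 2012], [Green–Tao–Ziegler 2012]")

into the estimate (targ) of the proof of Theorem 3.2.  Here we prove the COMBINED statement the proof of
Theorem 3.2 consumes, in the special case `aⱼ = 1` of the tree's fact (shifts `n + cⱼ d` with distinct
natural `cⱼ`), directly from the tree's PROVED Green–Tao machinery — Prop. 7.1 (the generalised von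
Neumann theorem relative to a pseudorandom majorant, `GreenTao2010_generalisedVonNeumann_holds`, App. C)
and Prop. 6.4 (the pseudorandom majorant of the enveloping sieve, `GreenTao2010_pseudorandomDomination_holds`,
App. D) — and the level-`s` uniformity fact, following the paper's own reduction: the change of variables
`d = d₀ + ⋯ + d_s`, `n = n' - ∑ c_l d_l` of the proof of Lemma 5.2 puts the system
`(d ; n + c₀ d, …, n + c_s d)` into `s`-normal form (Green–Tao 2010, Def. 4.2), with constant fibres, and
the cut-off at `N^{3/5}` of Green–Tao's "Proof of the Main Theorem assuming Theorem 7.2" (§7) replaces the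
Fourier truncation of the cutoff.  Main result:

* `bilinear_vonMangoldtW_le` — for `s ≥ 1`, distinct `c : Fin (s+1) → ℕ` and `ε > 0` there are `w₀, H₀`
  with `|∑_{d,n ∈ [H]} (Λ'_{b,W}(d) - 1) ∏ⱼ gⱼ(n + cⱼ d)| ≤ ε H²` for all `H ≥ H₀`, all cutoffs
  `w₀ ≤ w ≤ ½ log log H` (`W = ∏_{p ≤ w} p`), all `b ∈ [W]` coprime to `W` and all `1`-bounded
  `gⱼ : ℤ → ℝ`, GIVEN `GreenTao2010_gowersUniformityAt s`.

(`Λ'` is `Λ` restricted to primes, as in Green–Tao; the paper's `Λ_{b,W}` uses `Λ`, the difference —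
prime powers — is discarded in the paper's proof of Theorem 3.2 anyway.)

## References

* T. Tao, J. Teräväinen, J. Théor. Nombres Bordeaux 30 (2018), no. 3, 997–1015, doi:10.5802/jtnb.1062,
  arXiv:1710.02112: §5, Lemma 5.2, Lemma 5.3 and the proof of Theorem 3.2 (display (targ)).
  [TaoTeravainenJTNB2018]
* B. Green, T. Tao, *Linear equations in primes*, Ann. of Math. (2) 171 (2010), 1753–1850: Def. 4.2,
  Prop. 6.4, Prop. 7.1, Thm. 7.2, §7 ("Proof of the Main Theorem assuming Theorem 7.2"). [GreenTao2010]
-/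

noncomputable section

open Finset
open scoped BigOperators

namespace Literature.NumberTheory.Sieve

namespace TaoTeravainen2018

/-! ### The extended system of the proof of Lemma 5.2 -/

section system

variable {s : ℕ}

/-- The `s`-normal-form extension of the system `(d ; n + c₀ d, …, n + c_s d)` on `ℤ²` in the variables
`(n', d₀, …, d_s) ∈ ℤ^{s+2}` of the proof of Lemma 5.2 ("making a change of variables
`d = d₁ + ⋯ + d_k`, `n = n' - d₁b₁ - ⋯ - d_k b_k`"): form `0` is `d₀ + ⋯ + d_s`, form `j+1` is
`n' + ∑_l (c_j - c_l) d_l`. [cite: TaoTeravainenJTNB2018, proof of Lemma 5.2] -/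
def extSystem (c : Fin (s + 1) → ℕ) : Fin (s + 2) → AffLinForm (s + 2) :=
  Fin.cons ⟨Fin.cons 0 fun _ => 1, 0⟩ fun j => ⟨Fin.cons 1 fun l => (c j : ℤ) - c l, 0⟩

/-- `d = d₀ + ⋯ + d_s` at a lattice point of `ℤ^{s+2}`. [cite: TaoTeravainenJTNB2018, proof of Lemma 5.2] -/
def dSum (n : Fin (s + 2) → ℤ) : ℤ := ∑ l : Fin (s + 1), n l.succ

/-- `n = n' - ∑_l c_l d_l` at a lattice point of `ℤ^{s+2}`. [cite: TaoTeravainenJTNB2018, proof of Lemma 5.2] -/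
def nVal (c : Fin (s + 1) → ℕ) (n : Fin (s + 2) → ℤ) : ℤ := n 0 - ∑ l : Fin (s + 1), (c l : ℤ) * n l.succ

/-- Real extension of `dSum`. [folklore] -/
def dSumR (x : Fin (s + 2) → ℝ) : ℝ := ∑ l : Fin (s + 1), x l.succ

/-- Real extension of `nVal`. [folklore] -/
def nValR (c : Fin (s + 1) → ℕ) (x : Fin (s + 2) → ℝ) : ℝ := x 0 - ∑ l : Fin (s + 1), (c l : ℝ) * x l.succ

/-- Unfolding form `0` of the extended system. [folklore] -/
theorem extSystem_zero (c : Fin (s + 1) → ℕ) : extSystem c 0 = ⟨Fin.cons 0 fun _ => 1, 0⟩ := by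
  simp [extSystem]

/-- Unfolding forms `j+1` of the extended system. [folklore] -/
theorem extSystem_succ (c : Fin (s + 1) → ℕ) (j : Fin (s + 1)) :
    extSystem c j.succ = ⟨Fin.cons 1 fun l => (c j : ℤ) - c l, 0⟩ := by
  simp [extSystem]

/-- Form `0` evaluates to `d`. [cite: TaoTeravainenJTNB2018, proof of Lemma 5.2] -/
theorem eval_extSystem_zero (c : Fin (s + 1) → ℕ) (n : Fin (s + 2) → ℤ) :
    (extSystem c 0).eval n = dSum n := by
  simp [extSystem_zero, AffLinForm.eval, dSum, Fin.sum_univ_succ]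

/-- Form `j+1` evaluates to `n + c_j d`. [cite: TaoTeravainenJTNB2018, proof of Lemma 5.2] -/
theorem eval_extSystem_succ (c : Fin (s + 1) → ℕ) (j : Fin (s + 1)) (n : Fin (s + 2) → ℤ) :
    (extSystem c j.succ).eval n = nVal c n + c j * dSum n := by
  rw [AffLinForm.eval, Fin.sum_univ_succ]
  simp only [extSystem_succ, Fin.cons_zero, Fin.cons_succ, one_mul, add_zero, nVal, dSum, Finset.mul_sum]
  have : ∑ l : Fin (s + 1), ((c j : ℤ) - c l) * n l.succ =
      ∑ l : Fin (s + 1), (c j : ℤ) * n l.succ - ∑ l : Fin (s + 1), (c l : ℤ) * n l.succ := by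
    rw [← Finset.sum_sub_distrib]; exact Finset.sum_congr rfl fun l _ => by ring
  rw [this]; ring

/-- Real form `0` is `dSumR`. [folklore] -/
theorem realEval_extSystem_zero (c : Fin (s + 1) → ℕ) (x : Fin (s + 2) → ℝ) :
    (extSystem c 0).realEval x = dSumR x := by
  simp [extSystem_zero, AffLinForm.realEval, dSumR, Fin.sum_univ_succ]

/-- Real form `j+1` is `nValR + c_j dSumR`. [folklore] -/
theorem realEval_extSystem_succ (c : Fin (s + 1) → ℕ) (j : Fin (s + 1)) (x : Fin (s + 2) → ℝ) :
    (extSystem c j.succ).realEval x = nValR c x + c j * dSumR x := by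
  rw [AffLinForm.realEval, Fin.sum_univ_succ]
  simp only [extSystem_succ, Fin.cons_zero, Fin.cons_succ, Int.cast_one, one_mul, Int.cast_zero, add_zero,
    nValR, dSumR, Finset.mul_sum, Int.cast_sub, Int.cast_natCast]
  have : ∑ l : Fin (s + 1), ((c j : ℝ) - c l) * x l.succ =
      ∑ l : Fin (s + 1), (c j : ℝ) * x l.succ - ∑ l : Fin (s + 1), (c l : ℝ) * x l.succ := by
    rw [← Finset.sum_sub_distrib]; exact Finset.sum_congr rfl fun l _ => by ring
  rw [this]; ring

/-- The coefficients of the extended system, form `0`. [folklore] -/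
theorem coeff_extSystem_zero (c : Fin (s + 1) → ℕ) :
    (extSystem c 0).coeff = Fin.cons 0 fun _ => 1 := by
  rw [extSystem_zero]

/-- The coefficients of the extended system, forms `j+1`. [folklore] -/
theorem coeff_extSystem_succ (c : Fin (s + 1) → ℕ) (j : Fin (s + 1)) :
    (extSystem c j.succ).coeff = Fin.cons 1 fun l => (c j : ℤ) - c l := by
  rw [extSystem_succ]

/-- The extended system has no constant terms. [folklore] -/
theorem const_extSystem (c : Fin (s + 1) → ℕ) (i : Fin (s + 2)) : (extSystem c i).const = 0 := by
  refine Fin.cases ?_ (fun j => ?_) i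
  · rw [extSystem_zero]
  · rw [extSystem_succ]

/-- `d = 0` at the test point `e₀`. [folklore] -/
private theorem dSum_single_zero : dSum (Pi.single (0 : Fin (s + 2)) (1 : ℤ)) = 0 := by
  simp [dSum, Fin.succ_ne_zero]

/-- `n = 1` at the test point `e₀`. [folklore] -/
private theorem nVal_single_zero (c : Fin (s + 1) → ℕ) : nVal c (Pi.single (0 : Fin (s + 2)) (1 : ℤ)) = 1 := by
  simp [nVal, Fin.succ_ne_zero]

/-- `d = 1` at the test point `e_{l+1}`. [folklore] -/
private theorem dSum_single_succ (l₀ : Fin (s + 1)) : dSum (Pi.single (l₀.succ : Fin (s + 2)) (1 : ℤ)) = 1 := by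
  simp [dSum, Pi.single_apply, Fin.succ_inj]

/-- `n = -c_l` at the test point `e_{l+1}`. [folklore] -/
private theorem nVal_single_succ (c : Fin (s + 1) → ℕ) (l₀ : Fin (s + 1)) :
    nVal c (Pi.single (l₀.succ : Fin (s + 2)) (1 : ℤ)) = -(c l₀ : ℤ) := by
  simp [nVal, Pi.single_apply, Fin.succ_inj, (Fin.succ_ne_zero l₀).symm]

/-- The extended system satisfies Green–Tao's standing hypotheses (Def. 1.1) when the shifts are
distinct. [cite: GreenTao2010, Def. 1.1] -/
theorem isNondegenerateSystem_extSystem {c : Fin (s + 1) → ℕ} (hc : Function.Injective c) :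
    IsNondegenerateSystem (extSystem c) := by
  constructor
  · intro i
    refine Fin.cases ?_ (fun j => ?_) i
    · rw [coeff_extSystem_zero]
      intro h
      have := congr_fun h (Fin.succ 0)
      simp at this
    · rw [coeff_extSystem_succ]
      intro h
      have := congr_fun h 0
      simp at this
  · intro i i' hii' a b hab
    -- test points: `e0 = (1, 0, …, 0)` and `eL l = e_{l+1}`
    have key0 : ∀ j : Fin (s + 1), (extSystem c j.succ).eval (Pi.single 0 1) = 1 := fun j => by
      rw [eval_extSystem_succ, nVal_single_zero, dSum_single_zero]; ring
    have key0' : (extSystem c 0).eval (Pi.single 0 1) = 0 := by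
      rw [eval_extSystem_zero, dSum_single_zero]
    have keyL : ∀ j l : Fin (s + 1), (extSystem c j.succ).eval (Pi.single l.succ 1) = (c j : ℤ) - c l :=
      fun j l => by rw [eval_extSystem_succ, nVal_single_succ, dSum_single_succ]; ring
    have keyL' : ∀ l : Fin (s + 1), (extSystem c 0).eval (Pi.single l.succ 1) = 1 := fun l => by
      rw [eval_extSystem_zero, dSum_single_succ]
    revert hii' hab
    refine Fin.cases ?_ (fun j => ?_) i <;> refine Fin.cases ?_ (fun j' => ?_) i' <;> intro hii' hab
    · exact absurd rfl hii'
    · have h0 := hab (Pi.single 0 1)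
      rw [key0', key0] at h0
      have hb : b = 0 := by linarith
      have h1 := hab (Pi.single j'.succ 1)
      rw [keyL', keyL, hb] at h1
      simp at h1
      exact ⟨h1, hb⟩
    · have h0 := hab (Pi.single 0 1)
      rw [key0', key0] at h0
      have ha : a = 0 := by linarith
      have h1 := hab (Pi.single j.succ 1)
      rw [keyL', keyL, ha] at h1
      simp at h1
      exact ⟨ha, h1.symm⟩
    · have h0 := hab (Pi.single 0 1)
      rw [key0, key0] at h0
      have hab' : a = b := by linarith
      have hjj' : j ≠ j' := fun h => hii' (by rw [h])
      have h1 := hab (Pi.single j'.succ 1)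
      rw [keyL, keyL, sub_self, mul_zero] at h1
      have hcc : (c j : ℤ) - c j' ≠ 0 := by
        intro h
        have : c j = c j' := by exact_mod_cast (sub_eq_zero.mp h)
        exact hjj' (hc this)
      have ha : a = 0 := by
        rcases mul_eq_zero.mp h1 with h | h
        · exact h
        · exact absurd h hcc
      exact ⟨ha, hab' ▸ ha⟩

/-- The extended system is in `s`-normal form (this is the point of the change of variables).
[cite: TaoTeravainenJTNB2018, proof of Lemma 5.2] [cite: GreenTao2010, Def. 4.2] -/
theorem isNormalForm_extSystem {c : Fin (s + 1) → ℕ} (hc : Function.Injective c) :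
    IsNormalForm s (extSystem c) := by
  intro i
  refine Fin.cases ?_ (fun j => ?_) i
  · -- form `0`: `J = {d₀, …, d_s}`
    refine ⟨Finset.univ.map ⟨Fin.succ, Fin.succ_injective _⟩, ?_, ?_, ?_⟩
    · simp
    · rw [Finset.prod_map, coeff_extSystem_zero]
      simp
    · intro i' hi'
      revert hi'
      refine Fin.cases (fun h => absurd rfl h) (fun j' _ => ?_) i'
      rw [Finset.prod_map, coeff_extSystem_succ]
      exact Finset.prod_eq_zero (Finset.mem_univ j') (by simp)
  · -- form `j+1`: `J = {n'} ∪ {d_l : l ≠ j}`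
    refine ⟨insert 0 ((Finset.univ.erase j).map ⟨Fin.succ, Fin.succ_injective _⟩), ?_, ?_, ?_⟩
    · have h0 : (0 : Fin (s + 2)) ∉ (Finset.univ.erase j).map ⟨Fin.succ, Fin.succ_injective _⟩ := by
        simp only [Finset.mem_map, Finset.mem_erase, Finset.mem_univ, Function.Embedding.coeFn_mk,
          not_exists, not_and]
        exact fun l _ => Fin.succ_ne_zero l
      rw [Finset.card_insert_of_notMem h0, Finset.card_map, Finset.card_erase_of_mem (Finset.mem_univ j),
        Finset.card_univ, Fintype.card_fin]
      omega
    · have h0 : (0 : Fin (s + 2)) ∉ (Finset.univ.erase j).map ⟨Fin.succ, Fin.succ_injective _⟩ := by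
        simp only [Finset.mem_map, Finset.mem_erase, Finset.mem_univ, Function.Embedding.coeFn_mk,
          not_exists, not_and]
        exact fun l _ => Fin.succ_ne_zero l
      rw [Finset.prod_insert h0, Finset.prod_map, coeff_extSystem_succ]
      simp only [Fin.cons_zero, Function.Embedding.coeFn_mk, Fin.cons_succ, one_mul]
      refine Finset.prod_ne_zero_iff.mpr fun l hl => ?_
      have hlj : l ≠ j := (Finset.mem_erase.mp hl).1
      intro h
      have : c j = c l := by exact_mod_cast (sub_eq_zero.mp h)
      exact hlj (hc this).symm
    · intro i' hi'
      revert hi'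
      refine Fin.cases (fun _ => ?_) (fun j' hj' => ?_) i'
      · exact Finset.prod_eq_zero (Finset.mem_insert_self _ _) (by rw [coeff_extSystem_zero]; simp)
      · have hjj' : j' ≠ j := fun h => hj' (by rw [h])
        have hmem : (j'.succ : Fin (s + 2)) ∈
            insert 0 ((Finset.univ.erase j).map ⟨Fin.succ, Fin.succ_injective _⟩) := by
          refine Finset.mem_insert_of_mem (Finset.mem_map.mpr ⟨j', ?_, rfl⟩)
          exact Finset.mem_erase.mpr ⟨hjj', Finset.mem_univ _⟩
        exact Finset.prod_eq_zero hmem (by rw [coeff_extSystem_succ]; simp)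

/-- Coefficient bound of the extended system: `|coeff| ≤ 1 + 2 ∑ c_l`. [folklore] -/
theorem abs_coeff_extSystem_le (c : Fin (s + 1) → ℕ) (i e : Fin (s + 2)) :
    |((extSystem c i).coeff e : ℝ)| ≤ 1 + 2 * ∑ l, (c l : ℝ) := by
  have hsum : ∀ l : Fin (s + 1), (c l : ℝ) ≤ ∑ l', (c l' : ℝ) := fun l =>
    Finset.single_le_sum (f := fun l' => (c l' : ℝ)) (fun _ _ => by positivity) (Finset.mem_univ l)
  have hS : 0 ≤ ∑ l', (c l' : ℝ) := Finset.sum_nonneg fun _ _ => by positivity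
  refine Fin.cases ?_ (fun j => ?_) i
  · rw [coeff_extSystem_zero]
    refine Fin.cases ?_ (fun l => ?_) e
    · simp only [Fin.cons_zero, Int.cast_zero, abs_zero]; linarith
    · simp only [Fin.cons_succ, Int.cast_one, abs_one]; linarith
  · rw [coeff_extSystem_succ]
    refine Fin.cases ?_ (fun l => ?_) e
    · simp only [Fin.cons_zero, Int.cast_one, abs_one]; linarith
    · simp only [Fin.cons_succ, Int.cast_sub, Int.cast_natCast]
      have h1 := hsum j
      have h2 := hsum l
      have hcj : (0 : ℝ) ≤ c j := by positivity
      have hcl : (0 : ℝ) ≤ c l := by positivity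
      rw [abs_le]; constructor <;> linarith

/-- The size of the extended system: `‖Ψ‖_N ≤ (s+2)² (1 + 2 ∑ c_l)` (integer coefficients, no constant
terms). [cite: GreenTao2010, (1.1)] -/
theorem affLinSize_extSystem_le (c : Fin (s + 1) → ℕ) (N : ℝ) :
    affLinSize (extSystem c) N ≤ ((s + 2) ^ 2 * (1 + 2 * ∑ l, c l) : ℕ) := by
  unfold affLinSize
  have hconst : ∑ i, |((extSystem c i).const : ℝ) / N| = 0 :=
    Finset.sum_eq_zero fun i _ => by rw [const_extSystem]; simp
  rw [hconst, add_zero]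
  calc ∑ i, ∑ e, |((extSystem c i).coeff e : ℝ)|
      ≤ ∑ _i : Fin (s + 2), ∑ _e : Fin (s + 2), (1 + 2 * ∑ l, (c l : ℝ)) :=
        Finset.sum_le_sum fun i _ => Finset.sum_le_sum fun e _ => abs_coeff_extSystem_le c i e
    _ = ((s + 2) ^ 2 * (1 + 2 * ∑ l, c l) : ℕ) := by
        rw [Finset.sum_const, Finset.sum_const, Finset.card_univ, Fintype.card_fin]
        push_cast
        ring

end system

/-! ### The convex body and the fibre identity -/

section body

variable {s : ℕ}

/-- `dSumR` is linear. [folklore] -/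
theorem dSumR_add_smul (a b : ℝ) (x y : Fin (s + 2) → ℝ) :
    dSumR (a • x + b • y) = a * dSumR x + b * dSumR y := by
  simp only [dSumR, Pi.add_apply, Pi.smul_apply, smul_eq_mul, Finset.sum_add_distrib, Finset.mul_sum]

/-- `nValR` is linear. [folklore] -/
theorem nValR_add_smul (c : Fin (s + 1) → ℕ) (a b : ℝ) (x y : Fin (s + 2) → ℝ) :
    nValR c (a • x + b • y) = a * nValR c x + b * nValR c y := by
  simp only [nValR, Pi.add_apply, Pi.smul_apply, smul_eq_mul, mul_sub, Finset.mul_sum]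
  have : ∑ l : Fin (s + 1), (c l : ℝ) * (a * x l.succ + b * y l.succ) =
      ∑ l : Fin (s + 1), a * ((c l : ℝ) * x l.succ) + ∑ l : Fin (s + 1), b * ((c l : ℝ) * y l.succ) := by
    rw [← Finset.sum_add_distrib]; exact Finset.sum_congr rfl fun l _ => by ring
  rw [this]; ring

/-- The convex body `K'` of the reduction (in the coordinates `(n', d₀, …, d_s)`): `m ≤ d ≤ H`,
`m ≤ n ≤ H`, and the free fibre coordinates `d₁, …, d_s ∈ [1, H]`.
[cite: TaoTeravainenJTNB2018, proof of Lemma 5.2] -/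
def extBody (c : Fin (s + 1) → ℕ) (m H : ℝ) : Set (Fin (s + 2) → ℝ) :=
  {x | m ≤ dSumR x ∧ dSumR x ≤ H ∧ m ≤ nValR c x ∧ nValR c x ≤ H ∧
    ∀ j : Fin s, 1 ≤ x j.succ.succ ∧ x j.succ.succ ≤ H}

/-- `K'` is convex (an intersection of half-spaces). [folklore] -/
theorem convex_extBody (c : Fin (s + 1) → ℕ) (m H : ℝ) : Convex ℝ (extBody c m H) := by
  intro x hx y hy a b ha hb hab
  obtain ⟨h1, h2, h3, h4, h5⟩ := hx
  obtain ⟨h1', h2', h3', h4', h5'⟩ := hy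
  have habm : a * m + b * m = m := by rw [← add_mul, hab, one_mul]
  have habH : a * H + b * H = H := by rw [← add_mul, hab, one_mul]
  have hab1 : a * 1 + b * 1 = 1 := by rw [← add_mul, hab, one_mul]
  refine ⟨?_, ?_, ?_, ?_, fun j => ⟨?_, ?_⟩⟩
  · rw [dSumR_add_smul]; nlinarith [mul_le_mul_of_nonneg_left h1 ha, mul_le_mul_of_nonneg_left h1' hb]
  · rw [dSumR_add_smul]; nlinarith [mul_le_mul_of_nonneg_left h2 ha, mul_le_mul_of_nonneg_left h2' hb]
  · rw [nValR_add_smul]; nlinarith [mul_le_mul_of_nonneg_left h3 ha, mul_le_mul_of_nonneg_left h3' hb]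
  · rw [nValR_add_smul]; nlinarith [mul_le_mul_of_nonneg_left h4 ha, mul_le_mul_of_nonneg_left h4' hb]
  · simp only [Pi.add_apply, Pi.smul_apply, smul_eq_mul]
    nlinarith [mul_le_mul_of_nonneg_left (h5 j).1 ha, mul_le_mul_of_nonneg_left (h5' j).1 hb]
  · simp only [Pi.add_apply, Pi.smul_apply, smul_eq_mul]
    nlinarith [mul_le_mul_of_nonneg_left (h5 j).2 ha, mul_le_mul_of_nonneg_left (h5' j).2 hb]

/-- The scale factor `L₀ = (s+2)(∑ c_l + 1)` between `H` and the box containing `K'`. [folklore] -/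
def scaleConst (c : Fin (s + 1) → ℕ) : ℕ := (s + 2) * (∑ l, c l + 1)

/-- `L₀ ≥ 1`. [folklore] -/
theorem one_le_scaleConst (c : Fin (s + 1) → ℕ) : 1 ≤ scaleConst c := by
  unfold scaleConst; nlinarith [Nat.zero_le (∑ l, c l)]

/-- Coordinates of points of `K'` are bounded by `L₀ H` (for `m ≥ 1`, `H ≥ 0`). [folklore] -/
theorem abs_apply_le_of_mem_extBody {c : Fin (s + 1) → ℕ} {m H : ℝ} (hm : 1 ≤ m) (hH : 0 ≤ H)
    {x : Fin (s + 2) → ℝ} (hx : x ∈ extBody c m H) (i : Fin (s + 2)) :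
    |x i| ≤ scaleConst c * H := by
  obtain ⟨h1, h2, h3, h4, h5⟩ := hx
  have hCs0 : (0 : ℝ) ≤ ∑ l, (c l : ℝ) := Finset.sum_nonneg fun _ _ => by positivity
  have hs0 : (0 : ℝ) ≤ s := by positivity
  -- free coordinates
  have hfree : ∀ j : Fin s, |x j.succ.succ| ≤ H := fun j => by
    rw [abs_le]; constructor <;> linarith [(h5 j).1, (h5 j).2]
  -- the dependent fibre coordinate `d₀`
  have hsumfree : 0 ≤ ∑ j : Fin s, x j.succ.succ ∧ ∑ j : Fin s, x j.succ.succ ≤ s * H := by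
    constructor
    · exact Finset.sum_nonneg fun j _ => by linarith [(h5 j).1]
    · calc ∑ j : Fin s, x j.succ.succ ≤ ∑ _j : Fin s, H := Finset.sum_le_sum fun j _ => (h5 j).2
        _ = s * H := by rw [Finset.sum_const, Finset.card_univ, Fintype.card_fin, nsmul_eq_mul]
  have hd0 : |x (Fin.succ 0)| ≤ (s + 1) * H := by
    have hsplit : dSumR x = x (Fin.succ 0) + ∑ j : Fin s, x j.succ.succ := by
      unfold dSumR; rw [Fin.sum_univ_succ]
    rw [abs_le]; constructor <;> nlinarith [hsumfree.1, hsumfree.2]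
  have hall : ∀ l : Fin (s + 1), |x l.succ| ≤ (s + 1) * H := by
    intro l
    refine Fin.cases ?_ (fun j => ?_) l
    · exact hd0
    · exact (hfree j).trans (by nlinarith)
  -- the coordinate `n'`
  have hn : |x 0| ≤ H + (∑ l, (c l : ℝ)) * ((s + 1) * H) := by
    have hsplit : x 0 = nValR c x + ∑ l : Fin (s + 1), (c l : ℝ) * x l.succ := by
      unfold nValR; ring
    have hsum : |∑ l : Fin (s + 1), (c l : ℝ) * x l.succ| ≤ (∑ l, (c l : ℝ)) * ((s + 1) * H) := by
      calc |∑ l : Fin (s + 1), (c l : ℝ) * x l.succ| ≤ ∑ l : Fin (s + 1), |(c l : ℝ) * x l.succ| :=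
            Finset.abs_sum_le_sum_abs _ _
        _ ≤ ∑ l : Fin (s + 1), (c l : ℝ) * ((s + 1) * H) := Finset.sum_le_sum fun l _ => by
            rw [abs_mul, abs_of_nonneg (by positivity : (0 : ℝ) ≤ c l)]
            exact mul_le_mul_of_nonneg_left (hall l) (by positivity)
        _ = (∑ l, (c l : ℝ)) * ((s + 1) * H) := (Finset.sum_mul _ _ _).symm
    have hnv : |nValR c x| ≤ H := by rw [abs_le]; constructor <;> linarith
    rw [hsplit]
    exact (abs_add_le _ _).trans (add_le_add hnv hsum)
  have hL : (scaleConst c : ℝ) * H = (s + 2) * (∑ l, (c l : ℝ) + 1) * H := by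
    unfold scaleConst; push_cast; ring
  rw [hL]
  refine Fin.cases ?_ (fun l => ?_) i
  · exact hn.trans (by nlinarith)
  · exact (hall l).trans (by nlinarith)

/-- `K' ⊆ [-L₀H, L₀H]^{s+2}`. [folklore] -/
theorem extBody_subset_realBox {c : Fin (s + 1) → ℕ} {m H : ℝ} (hm : 1 ≤ m) (hH : 0 ≤ H) :
    extBody c m H ⊆ realBox (s + 2) (scaleConst c * H) := by
  intro x hx
  refine ⟨fun i => ?_, fun i => ?_⟩
  · exact (abs_le.mp (abs_apply_le_of_mem_extBody hm hH hx i)).1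
  · exact (abs_le.mp (abs_apply_le_of_mem_extBody hm hH hx i)).2

/-- On `K'` all forms of the extended system take values in `[1, L₀ H]`. [folklore] -/
theorem realEval_extSystem_mem {c : Fin (s + 1) → ℕ} {m H : ℝ} (hm : 1 ≤ m) (hH : 0 ≤ H)
    {x : Fin (s + 2) → ℝ} (hx : x ∈ extBody c m H) (i : Fin (s + 2)) :
    1 ≤ (extSystem c i).realEval x ∧ (extSystem c i).realEval x ≤ scaleConst c * H := by
  obtain ⟨h1, h2, h3, h4, -⟩ := hx
  have hCs0 : (0 : ℝ) ≤ ∑ l, (c l : ℝ) := Finset.sum_nonneg fun _ _ => by positivity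
  have hs0 : (0 : ℝ) ≤ s := by positivity
  have hL : (scaleConst c : ℝ) * H = (s + 2) * (∑ l, (c l : ℝ) + 1) * H := by
    unfold scaleConst; push_cast; ring
  rw [hL]
  have hone : (1 : ℝ) ≤ (s + 2) * (∑ l, (c l : ℝ) + 1) := by nlinarith
  have hbig : (∑ l, (c l : ℝ) + 1) * H ≤ (s + 2) * (∑ l, (c l : ℝ) + 1) * H := by
    have : (0 : ℝ) ≤ (∑ l, (c l : ℝ) + 1) * H := by positivity
    nlinarith
  have hHle : H ≤ (∑ l, (c l : ℝ) + 1) * H := by nlinarith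
  refine Fin.cases ?_ (fun j => ?_) i
  · rw [realEval_extSystem_zero]
    exact ⟨by linarith, by linarith⟩
  · rw [realEval_extSystem_succ]
    have hcj : (0 : ℝ) ≤ c j := by positivity
    have hcjle : (c j : ℝ) ≤ ∑ l, (c l : ℝ) :=
      Finset.single_le_sum (f := fun l => (c l : ℝ)) (fun _ _ => by positivity) (Finset.mem_univ j)
    have hd0 : (0 : ℝ) ≤ dSumR x := le_trans (by linarith) h1
    constructor
    · nlinarith [mul_nonneg hcj hd0]
    · have h5 : (c j : ℝ) * dSumR x ≤ (∑ l, (c l : ℝ)) * H :=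
        (mul_le_mul_of_nonneg_left h2 hcj).trans (mul_le_mul_of_nonneg_right hcjle hH)
      nlinarith

/-- `dSumR` at a lattice point. [folklore] -/
theorem dSumR_realPoint (n : Fin (s + 2) → ℤ) : dSumR (realPoint n) = (dSum n : ℝ) := by
  simp [dSumR, dSum, realPoint]

/-- `nValR` at a lattice point. [folklore] -/
theorem nValR_realPoint (c : Fin (s + 1) → ℕ) (n : Fin (s + 2) → ℤ) :
    nValR c (realPoint n) = (nVal c n : ℝ) := by
  simp [nValR, nVal, realPoint]

/-- The integer description of the lattice points of `K'`. [folklore] -/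
def InBox (c : Fin (s + 1) → ℕ) (m H : ℤ) (n : Fin (s + 2) → ℤ) : Prop :=
  m ≤ dSum n ∧ dSum n ≤ H ∧ m ≤ nVal c n ∧ nVal c n ≤ H ∧ ∀ j : Fin s, 1 ≤ n j.succ.succ ∧ n j.succ.succ ≤ H

/-- A lattice point lies in `K'` iff its integer coordinates satisfy the defining inequalities. [folklore] -/
theorem realPoint_mem_extBody_iff (c : Fin (s + 1) → ℕ) (m H : ℤ) (n : Fin (s + 2) → ℤ) :
    realPoint n ∈ extBody c m H ↔ InBox c m H n := by
  simp only [extBody, Set.mem_setOf_eq, dSumR_realPoint, nValR_realPoint, InBox, realPoint]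
  constructor
  · rintro ⟨h1, h2, h3, h4, h5⟩
    exact ⟨by exact_mod_cast h1, by exact_mod_cast h2, by exact_mod_cast h3, by exact_mod_cast h4,
      fun j => ⟨by exact_mod_cast (h5 j).1, by exact_mod_cast (h5 j).2⟩⟩
  · rintro ⟨h1, h2, h3, h4, h5⟩
    exact ⟨by exact_mod_cast h1, by exact_mod_cast h2, by exact_mod_cast h3, by exact_mod_cast h4,
      fun j => ⟨by exact_mod_cast (h5 j).1, by exact_mod_cast (h5 j).2⟩⟩

/-- The parametrisation of the lattice points of `K'` by `(n, d)` and the free fibre coordinates: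
`(n, d, e) ↦ (n + ∑ c_l d_l, d₀ = d - ∑ e_j, e)`. [cite: TaoTeravainenJTNB2018, proof of Lemma 5.2] -/
def mkPoint (c : Fin (s + 1) → ℕ) (q : (ℤ × ℤ) × (Fin s → ℤ)) : Fin (s + 2) → ℤ :=
  let d : Fin (s + 1) → ℤ := Fin.cons (q.1.2 - ∑ j, q.2 j) q.2
  Fin.cons (q.1.1 + ∑ l, (c l : ℤ) * d l) d

/-- The inverse parametrisation. [folklore] -/
def splitPoint (c : Fin (s + 1) → ℕ) (n : Fin (s + 2) → ℤ) : (ℤ × ℤ) × (Fin s → ℤ) :=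
  ((nVal c n, dSum n), fun j => n j.succ.succ)

/-- `d` of the parametrised point. [folklore] -/
theorem dSum_mkPoint (c : Fin (s + 1) → ℕ) (q : (ℤ × ℤ) × (Fin s → ℤ)) : dSum (mkPoint c q) = q.1.2 := by
  simp only [dSum, mkPoint, Fin.cons_succ]
  rw [Fin.sum_univ_succ]
  simp

/-- `n` of the parametrised point. [folklore] -/
theorem nVal_mkPoint (c : Fin (s + 1) → ℕ) (q : (ℤ × ℤ) × (Fin s → ℤ)) : nVal c (mkPoint c q) = q.1.1 := by
  simp only [nVal, mkPoint, Fin.cons_succ, Fin.cons_zero]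
  ring

/-- The free fibre coordinates of the parametrised point. [folklore] -/
theorem mkPoint_succ_succ (c : Fin (s + 1) → ℕ) (q : (ℤ × ℤ) × (Fin s → ℤ)) (j : Fin s) :
    mkPoint c q j.succ.succ = q.2 j := by
  simp [mkPoint]

/-- `splitPoint ∘ mkPoint = id`. [folklore] -/
theorem splitPoint_mkPoint (c : Fin (s + 1) → ℕ) (q : (ℤ × ℤ) × (Fin s → ℤ)) :
    splitPoint c (mkPoint c q) = q := by
  ext
  · exact nVal_mkPoint c q
  · exact dSum_mkPoint c q
  · exact mkPoint_succ_succ c q _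

/-- `mkPoint ∘ splitPoint = id`. [folklore] -/
theorem mkPoint_splitPoint (c : Fin (s + 1) → ℕ) (n : Fin (s + 2) → ℤ) :
    mkPoint c (splitPoint c n) = n := by
  have hd : ∀ l : Fin (s + 1),
      (Fin.cons (dSum n - ∑ j : Fin s, n j.succ.succ) (fun j : Fin s => n j.succ.succ) : Fin (s + 1) → ℤ) l =
        n l.succ := by
    intro l
    refine Fin.cases ?_ (fun j => ?_) l
    · simp only [Fin.cons_zero, dSum]
      rw [Fin.sum_univ_succ]; ring
    · simp
  funext i
  refine Fin.cases ?_ (fun l => ?_) i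
  · simp only [mkPoint, splitPoint, Fin.cons_zero]
    rw [Finset.sum_congr rfl fun l _ => by rw [hd l]]
    simp only [nVal]; ring
  · simp only [mkPoint, splitPoint, Fin.cons_succ]
    exact hd l

/-- The index set of the parametrisation. [folklore] -/
def paramSet (s : ℕ) (m H : ℤ) : Finset ((ℤ × ℤ) × (Fin s → ℤ)) :=
  (Icc m H ×ˢ Icc m H) ×ˢ Fintype.piFinset fun _ : Fin s => Icc (1 : ℤ) H

/-- Membership in the index set. [folklore] -/
theorem mem_paramSet_iff {m H : ℤ} {q : (ℤ × ℤ) × (Fin s → ℤ)} :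
    q ∈ paramSet s m H ↔ (m ≤ q.1.1 ∧ q.1.1 ≤ H) ∧ (m ≤ q.1.2 ∧ q.1.2 ≤ H) ∧ ∀ j, 1 ≤ q.2 j ∧ q.2 j ≤ H := by
  simp only [paramSet, Finset.mem_product, Finset.mem_Icc, Fintype.mem_piFinset, and_assoc]

/-- The fibres have `H^s` points. [folklore] -/
theorem card_paramSet_fibre (s : ℕ) (H : ℕ) :
    (Fintype.piFinset fun _ : Fin s => Icc (1 : ℤ) H).card = H ^ s := by
  rw [Fintype.card_piFinset, Finset.prod_const, Finset.card_univ, Fintype.card_fin, Int.card_Icc]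
  congr 1
  omega

open Classical in
/-- **The fibre identity**: summing a function of `(n, d) = (nVal, dSum)` over the lattice points of `K'`
in the box `[-N, N]^{s+2}` (`N ≥ L₀ H`) gives `H^s` times the sum over `(n, d) ∈ [m, H]²`.
[cite: TaoTeravainenJTNB2018, proof of Lemma 5.2 (change of variables)] -/
theorem sum_extBody_eq {c : Fin (s + 1) → ℕ} {m H N : ℕ} (hm : 1 ≤ m) (hN : scaleConst c * H ≤ N)
    (F : ℤ → ℤ → ℝ) :
    ∑ n ∈ (latticeBox (s + 2) N).filter (fun n => realPoint n ∈ extBody c m H), F (nVal c n) (dSum n) =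
      (H : ℝ) ^ s * ∑ p ∈ Icc (m : ℤ) H ×ˢ Icc (m : ℤ) H, F p.1 p.2 := by
  have hmr : (1 : ℝ) ≤ m := by exact_mod_cast hm
  have hHr : (0 : ℝ) ≤ H := by positivity
  -- reindex along the parametrisation
  have step : ∑ n ∈ (latticeBox (s + 2) N).filter (fun n => realPoint n ∈ extBody c m H),
      F (nVal c n) (dSum n) = ∑ q ∈ paramSet s m H, F q.1.1 q.1.2 := by
    refine Finset.sum_nbij' (splitPoint c) (mkPoint c) ?_ ?_ ?_ ?_ ?_
    · intro n hn
      have hK := (Finset.mem_filter.mp hn).2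
      have hK' : realPoint n ∈ extBody c ((m : ℤ) : ℝ) ((H : ℤ) : ℝ) := by exact_mod_cast hK
      obtain ⟨h1, h2, h3, h4, h5⟩ := (realPoint_mem_extBody_iff c m H n).mp hK'
      exact mem_paramSet_iff.mpr ⟨⟨h3, h4⟩, ⟨h1, h2⟩, h5⟩
    · intro q hq
      obtain ⟨⟨h1, h2⟩, ⟨h3, h4⟩, h5⟩ := mem_paramSet_iff.mp hq
      have hin : InBox c m H (mkPoint c q) := by
        refine ⟨?_, ?_, ?_, ?_, fun j => ?_⟩
        · rw [dSum_mkPoint]; exact h3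
        · rw [dSum_mkPoint]; exact h4
        · rw [nVal_mkPoint]; exact h1
        · rw [nVal_mkPoint]; exact h2
        · rw [mkPoint_succ_succ]; exact h5 j
      have hK' : realPoint (mkPoint c q) ∈ extBody c ((m : ℤ) : ℝ) ((H : ℤ) : ℝ) :=
        (realPoint_mem_extBody_iff c m H _).mpr hin
      have hK : realPoint (mkPoint c q) ∈ extBody c (m : ℝ) (H : ℝ) := by exact_mod_cast hK'
      refine Finset.mem_filter.mpr ⟨?_, hK⟩
      have hbox : realPoint (mkPoint c q) ∈ realBox (s + 2) (N : ℝ) :=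
        (extBody_subset_realBox hmr hHr).trans (realBox_mono _ (by exact_mod_cast hN)) hK
      exact mem_latticeBox_of_mem_realBox hbox
    · intro n _; exact mkPoint_splitPoint c n
    · intro q _; exact splitPoint_mkPoint c q
    · intro n _; rfl
  rw [step, paramSet, Finset.sum_product, ]
  simp only [Finset.sum_const, card_paramSet_fibre, nsmul_eq_mul, Nat.cast_pow]
  rw [Finset.mul_sum]

end body

/-! ### The bilinear estimate (Lemma 5.2 + Lemma 5.3 of Tao–Teräväinen, via Green–Tao Props. 6.4, 7.1, Thm. 7.2) -/

section main

variable {s : ℕ}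

/-- `|∏ⱼ gⱼ(xⱼ)| ≤ 1` for `1`-bounded `gⱼ`. [folklore] -/
theorem abs_prod_le_one_of_bounded {k : ℕ} {g : Fin k → ℤ → ℝ} (hg : ∀ j x, |g j x| ≤ 1) (y : Fin k → ℤ) :
    |∏ j, g j (y j)| ≤ 1 := by
  rw [Finset.abs_prod]
  exact Finset.prod_le_one (fun _ _ => abs_nonneg _) fun j _ => hg j (y j)

/-- The number of pairs `(n, d) ∈ [1,H]²` with `n < m` or `d < m` is at most `2 m H`. [folklore] -/
theorem card_sdiff_Icc_prod_le (m H : ℕ) :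
    ((Icc (1 : ℤ) H ×ˢ Icc (1 : ℤ) H) \ (Icc (m : ℤ) H ×ˢ Icc (m : ℤ) H)).card ≤ 2 * m * H := by
  have hsub : (Icc (1 : ℤ) H ×ˢ Icc (1 : ℤ) H) \ (Icc (m : ℤ) H ×ˢ Icc (m : ℤ) H) ⊆
      (Icc (1 : ℤ) ((m : ℤ) - 1) ×ˢ Icc (1 : ℤ) H) ∪ (Icc (1 : ℤ) H ×ˢ Icc (1 : ℤ) ((m : ℤ) - 1)) := by
    intro p hp
    rw [Finset.mem_sdiff, Finset.mem_product, Finset.mem_product, Finset.mem_Icc, Finset.mem_Icc,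
      Finset.mem_Icc, Finset.mem_Icc] at hp
    rw [Finset.mem_union, Finset.mem_product, Finset.mem_product, Finset.mem_Icc, Finset.mem_Icc,
      Finset.mem_Icc, Finset.mem_Icc]
    omega
  have hc1 : (Icc (1 : ℤ) ((m : ℤ) - 1)).card ≤ m := by rw [Int.card_Icc]; omega
  have hc2 : (Icc (1 : ℤ) H).card ≤ H := by rw [Int.card_Icc]; omega
  calc _ ≤ ((Icc (1 : ℤ) ((m : ℤ) - 1) ×ˢ Icc (1 : ℤ) H) ∪ (Icc (1 : ℤ) H ×ˢ Icc (1 : ℤ) ((m : ℤ) - 1))).card :=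
        Finset.card_le_card hsub
    _ ≤ (Icc (1 : ℤ) ((m : ℤ) - 1) ×ˢ Icc (1 : ℤ) H).card + (Icc (1 : ℤ) H ×ˢ Icc (1 : ℤ) ((m : ℤ) - 1)).card :=
        Finset.card_union_le _ _
    _ ≤ m * H + H * m := by
        rw [Finset.card_product, Finset.card_product]
        exact add_le_add (Nat.mul_le_mul hc1 hc2) (Nat.mul_le_mul hc2 hc1)
    _ = 2 * m * H := by ring

open Classical in
/-- **Tao–Teräväinen 2018, Lemma 5.2 combined with Lemma 5.3** (the estimate (targ) of the proof of
Theorem 3.2, case `aⱼ = 1`), CONDITIONAL on Green–Tao's Gowers uniformity estimate at level `s`: for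
`s ≥ 1`, distinct natural shifts `c₀, …, c_s` and `ε > 0` there are `w₀, H₀` such that for all `H ≥ H₀`, all
cutoffs `w₀ ≤ w ≤ ½ log log H` (`W = ∏_{p ≤ w} p`), all `b ∈ [W]` coprime to `W` and ALL `1`-bounded functions
`g₀, …, g_s : ℤ → ℝ`,
`|∑_{n, d ∈ [H]} (Λ'_{b,W}(d) - 1) ∏ⱼ gⱼ(n + cⱼ d)| ≤ ε H²`.
Proof as printed in §5 of the paper (reduction to a system in `s`-normal form by the change of variables
`d = ∑ d_l`, `n = n' - ∑ c_l d_l`, then the generalised von Neumann theorem and the uniformity of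
`Λ_{b,W} - 1`), with Green–Tao's Prop. 7.1 (`GreenTao2010_generalisedVonNeumann_holds`) as the von Neumann
theorem, their Prop. 6.4 (`GreenTao2010_pseudorandomDomination_holds`) for the majorant, and their §7 cut at
`N^{3/5}`. [cite: TaoTeravainenJTNB2018, Lemma 5.2, Lemma 5.3 and proof of Theorem 3.2]
[cite: GreenTao2010, Prop. 6.4, Prop. 7.1, Thm. 7.2, §7] -/
theorem bilinear_vonMangoldtW_le (hs : 1 ≤ s) {c : Fin (s + 1) → ℕ} (hc : Function.Injective c)
    (hU : GreenTao2010_gowersUniformityAt s) {ε : ℝ} (hε : 0 < ε) :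
    ∃ w₀ H₀ : ℕ, ∀ H : ℕ, H₀ ≤ H → ∀ w : ℕ, w₀ ≤ w → (w : ℝ) ≤ Real.log (Real.log H) / 2 →
      ∀ b : ℕ, 1 ≤ b → b ≤ primorial w → Nat.Coprime b (primorial w) →
        ∀ g : Fin (s + 1) → ℤ → ℝ, (∀ j x, |g j x| ≤ 1) →
          |∑ p ∈ Icc (1 : ℤ) H ×ˢ Icc (1 : ℤ) H,
              (vonMangoldtW (primorial w) b p.2.toNat - 1) * ∏ j, g j (p.1 + c j * p.2)| ≤ ε * (H : ℝ) ^ 2 := by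
  classical
  -- constants depending on `s, c`
  obtain ⟨L, hLdef⟩ : ∃ L : ℕ, L = (s + 2) ^ 2 * (1 + 2 * ∑ l, c l) := ⟨_, rfl⟩
  have hL1 : 1 ≤ L := by rw [hLdef]; exact Nat.mul_pos (pow_pos (by omega) 2) (by omega)
  obtain ⟨L₀, hL₀def⟩ : ∃ L₀ : ℕ, L₀ = scaleConst c := ⟨_, rfl⟩
  have hL₀1 : 1 ≤ L₀ := by rw [hL₀def]; exact one_le_scaleConst c
  have hL₀r1 : (1 : ℝ) ≤ L₀ := by exact_mod_cast hL₀1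
  have hL₀r0 : (0 : ℝ) < L₀ := by linarith
  obtain ⟨C₁, hC₁, D, hD, H71⟩ :=
    GreenTao2010_generalisedVonNeumann_holds s (s + 2) (s + 2) L hs (by omega) (by omega) hL1
  obtain ⟨C₀, hC₀, H64⟩ := GreenTao2010_pseudorandomDomination_holds (max D 2) 1 (le_max_right _ _) le_rfl
  obtain ⟨C, hCdef⟩ : ∃ C : ℝ, C = max C₁ C₀ := ⟨_, rfl⟩
  have hC₁C : C₁ ≤ C := by rw [hCdef]; exact le_max_left _ _
  have hC₀C : C₀ ≤ C := by rw [hCdef]; exact le_max_right _ _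
  have hC0 : 0 < C := lt_of_lt_of_le hC₁ hC₁C
  obtain ⟨M, hM, A, H64'⟩ := H64 C hC₀C
  -- tolerances and thresholds
  have hε₁ : 0 < ε / (2 * M ^ (s + 2) * (L₀ : ℝ) ^ (s + 2)) := by positivity
  obtain ⟨δ, hδ, η, hη, N₁', H71'⟩ := H71 C hC₁C A _ hε₁
  obtain ⟨w₂, N₂, H64''⟩ := H64' η hη
  obtain ⟨w₃, N₃, hU'⟩ := hU (M * δ / 2) (by positivity)
  obtain ⟨N₄, hN₄⟩ := logPow_cut_eventually
    (mul_nonneg (gowersPerturbConst_pos (s + 1)).le (by positivity) :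
      (0 : ℝ) ≤ gowersPerturbConst (s + 1) * M⁻¹ ^ 2 ^ (s + 1))
    (by positivity : (0 : ℝ) < (δ / 2) ^ 2 ^ (s + 1)) (2 ^ (s + 1))
  obtain ⟨N₅, hN₅⟩ := logPow_cut_eventually (le_of_lt two_pos : (0 : ℝ) ≤ 2)
    (by positivity : (0 : ℝ) < ε / (2 * L₀)) 1
  obtain ⟨F, hF⟩ : ∃ F : ℕ, F = ⌈1 / C⌉₊ := ⟨_, rfl⟩
  refine ⟨w₂ + w₃, N₁' + N₂ + N₃ + N₄ + N₅ + F + 2 * s + 4, ?_⟩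
  intro H hH w hw hwH b hb1 hbW hbcop g hg
  have hN₁'H : N₁' ≤ H := by omega
  have hN₂H : N₂ ≤ H := by omega
  have hN₃H : N₃ ≤ H := by omega
  have hN₄H : N₄ ≤ H := by omega
  have hN₅H : N₅ ≤ H := by omega
  have hFH : F ≤ H := by omega
  have hH2 : 2 ≤ H := by omega
  have hw₂ : w₂ ≤ w := by omega
  have hw₃ : w₃ ≤ w := by omega
  have hHr1 : (1 : ℝ) ≤ H := by exact_mod_cast (by omega : 1 ≤ H)
  have hHr0 : (0 : ℝ) < H := by linarith
  -- the scale `N₁ = L₀ H`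
  obtain ⟨N₁, hN₁⟩ : ∃ N₁ : ℕ, N₁ = L₀ * H := ⟨_, rfl⟩
  have hHN₁ : H ≤ N₁ := by rw [hN₁]; exact Nat.le_mul_of_pos_left H hL₀1
  have hN₁r : (N₁ : ℝ) = L₀ * H := by rw [hN₁]; push_cast; ring
  have hHN₁r : (H : ℝ) ≤ N₁ := by exact_mod_cast hHN₁
  have hN₁r1 : (1 : ℝ) ≤ N₁ := hHr1.trans hHN₁r
  have hN₁r0 : (0 : ℝ) < N₁ := by linarith
  have hN₁k : 2 * (s + 1 + 1) ≤ N₁ := by omega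
  have hwN₁ : (w : ℝ) ≤ Real.log (Real.log N₁) / 2 :=
    hwH.trans (by have := logLog_mono hH2 hHN₁; linarith)
  have hWH : primorial w ≤ H := by exact_mod_cast primorial_le_of_le_logLog hH2 hwH
  have hWN₁ : primorial w ≤ N₁ := hWH.trans hHN₁
  -- a prime `N' = p ∈ [C N₁, 2 C N₁]`
  have hCN₁ : 1 ≤ C * N₁ := by
    have hF1 : 1 / C ≤ F := by rw [hF]; exact Nat.le_ceil _
    have hFN₁ : (F : ℝ) ≤ N₁ := by exact_mod_cast hFH.trans hHN₁
    calc (1 : ℝ) = C * (1 / C) := by field_simp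
      _ ≤ C * N₁ := mul_le_mul_of_nonneg_left (hF1.trans hFN₁) hC0.le
  obtain ⟨p, hp, hCp, hp2⟩ := exists_prime_mem_Icc hCN₁
  haveI : NeZero p := ⟨hp.ne_zero⟩
  -- the pseudorandom majorant at scale `N₁` for the single residue `b`
  obtain ⟨ν, hν, hdom⟩ := H64'' N₁ (hN₂H.trans hHN₁) w hw₂ hwN₁ p hp hCp hp2 (fun _ : Fin 1 => b)
    (fun _ => ⟨hb1, hbW, hbcop⟩)
  have hdom1 : ∀ n : ℕ, (N₁ : ℝ) ^ ((3 : ℝ) / 5) ≤ n → n ≤ N₁ →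
      1 + vonMangoldtW (primorial w) b n ≤ M * ν (n : ZMod p) := by
    intro n h1 h2
    have := hdom n h1 h2
    simpa using this
  -- the cut-off `m = ⌈N₁^{3/5}⌉`
  obtain ⟨m, hm⟩ : ∃ m : ℕ, m = ⌈(N₁ : ℝ) ^ ((3 : ℝ) / 5)⌉₊ := ⟨_, rfl⟩
  have hm35 : (N₁ : ℝ) ^ ((3 : ℝ) / 5) ≤ m := by rw [hm]; exact Nat.le_ceil _
  have hm1 : 1 ≤ m := by rw [hm]; exact Nat.lt_ceil.mpr (by simpa using Real.rpow_pos_of_pos hN₁r0 _)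
  have hmr1 : (1 : ℝ) ≤ m := by exact_mod_cast hm1
  have hmle : (m : ℝ) ≤ (N₁ : ℝ) ^ ((3 : ℝ) / 5) + 1 := by
    rw [hm]; exact (Nat.ceil_lt_add_one (by positivity)).le
  -- the functions: `θ = M⁻¹ (Λ'_{b,W} - 1) 1_{[m,∞)}` and `gc j = M⁻¹ gⱼ 1_{[m,∞)}`
  obtain ⟨θ, hθ⟩ : ∃ θ : ℤ → ℝ,
      θ = fun x => if (m : ℤ) ≤ x then M⁻¹ * (vonMangoldtW (primorial w) b x.toNat - 1) else 0 := ⟨_, rfl⟩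
  obtain ⟨gc, hgc⟩ : ∃ gc : Fin (s + 1) → ℤ → ℝ,
      gc = fun j x => if (m : ℤ) ≤ x then M⁻¹ * g j x else 0 := ⟨_, rfl⟩
  obtain ⟨f, hfdef⟩ : ∃ f : Fin (s + 2) → ℤ → ℝ, f = Fin.cons θ gc := ⟨_, rfl⟩
  have hf0 : f 0 = θ := by rw [hfdef]; exact Fin.cons_zero _ _
  have hfs : ∀ j, f j.succ = gc j := fun j => by rw [hfdef]; exact Fin.cons_succ _ _ _
  -- domination on `[m, N₁]`
  have hdomx : ∀ x : ℤ, (m : ℤ) ≤ x → x ≤ N₁ →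
      M⁻¹ * (1 + vonMangoldtW (primorial w) b x.toNat) ≤ ν (x : ZMod p) := by
    intro x hmx hxN
    have hx0 : 0 ≤ x := by omega
    have hxnat : ((x.toNat : ℕ) : ℤ) = x := Int.toNat_of_nonneg hx0
    have h35 : (N₁ : ℝ) ^ ((3 : ℝ) / 5) ≤ (x.toNat : ℕ) := by
      have h2 : (m : ℝ) ≤ (x.toNat : ℕ) := by
        have : (m : ℤ) ≤ (x.toNat : ℤ) := by rw [hxnat]; exact hmx
        exact_mod_cast this
      linarith
    have hxN' : x.toNat ≤ N₁ := by omega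
    have hd := hdom1 x.toNat h35 hxN'
    have hcast : ((x : ℤ) : ZMod p) = ((x.toNat : ℕ) : ZMod p) := by
      conv_lhs => rw [← hxnat]
      exact Int.cast_natCast _
    rw [hcast]
    calc M⁻¹ * (1 + vonMangoldtW (primorial w) b x.toNat) ≤ M⁻¹ * (M * ν ((x.toNat : ℕ) : ZMod p)) :=
          mul_le_mul_of_nonneg_left hd (inv_nonneg.mpr hM.le)
      _ = ν _ := by field_simp
  have hfν : ∀ i, ∀ x : ℤ, 1 ≤ x → x ≤ N₁ → |f i x| ≤ ν (x : ZMod p) := by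
    intro i x hx1 hxN
    refine Fin.cases ?_ (fun j => ?_) i
    · rw [hf0]
      by_cases hmx : (m : ℤ) ≤ x
      · have hf' : θ x = M⁻¹ * (vonMangoldtW (primorial w) b x.toNat - 1) := by simp [hθ, hmx]
        have hΛ0 := (vonMangoldtW_nonneg_le_log (primorial w) b x.toNat).1
        have h1 : |vonMangoldtW (primorial w) b x.toNat - 1| ≤ 1 + vonMangoldtW (primorial w) b x.toNat := by
          rw [abs_le]; constructor <;> linarith
        rw [hf', abs_mul, abs_of_pos (inv_pos.mpr hM)]
        exact (mul_le_mul_of_nonneg_left h1 (inv_nonneg.mpr hM.le)).trans (hdomx x hmx hxN)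
      · have : θ x = 0 := by simp [hθ, hmx]
        rw [this, abs_zero]
        exact hν.1 _
    · rw [hfs]
      by_cases hmx : (m : ℤ) ≤ x
      · have hf' : gc j x = M⁻¹ * g j x := by simp [hgc, hmx]
        have hΛ0 := (vonMangoldtW_nonneg_le_log (primorial w) b x.toNat).1
        rw [hf', abs_mul, abs_of_pos (inv_pos.mpr hM)]
        calc M⁻¹ * |g j x| ≤ M⁻¹ * (1 + vonMangoldtW (primorial w) b x.toNat) :=
              mul_le_mul_of_nonneg_left ((hg j x).trans (by linarith)) (inv_nonneg.mpr hM.le)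
          _ ≤ _ := hdomx x hmx hxN
      · have : gc j x = 0 := by simp [hgc, hmx]
        rw [this, abs_zero]
        exact hν.1 _
  -- the Gowers norm of `f 0 = θ`: Thm. 7.2 at scale `N₁` plus the effect of the cut at `m`
  have hgowers : uniformityNorm (s + 1) N₁ (fun n => ((f 0 n : ℝ) : ℂ)) ≤ δ := by
    rw [hf0]
    set G : ℤ → ℂ := fun n => ((M⁻¹ : ℝ) : ℂ) * vonMangoldtWSubOne (primorial w) b n with hG
    have hlogN₁ : 0 ≤ Real.log ((N₁ : ℝ) + 1) := Real.log_nonneg (by linarith)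
    set B₀ : ℝ := M⁻¹ * (1 + 2 * Real.log ((N₁ : ℝ) + 1)) with hB₀
    have hB₀0 : 0 ≤ B₀ := mul_nonneg (inv_nonneg.mpr hM.le) (by linarith)
    have hGbd : ∀ x : ℤ, 1 ≤ x → x ≤ N₁ → ‖G x‖ ≤ B₀ := by
      intro x hx1 hxN
      simp only [hG, vonMangoldtWSubOne, norm_mul, Complex.norm_real, Real.norm_eq_abs,
        abs_of_pos (inv_pos.mpr hM)]
      exact mul_le_mul_of_nonneg_left (abs_vonMangoldtW_sub_one_le hWN₁ hbW hx1 hxN)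
        (inv_nonneg.mpr hM.le)
    have hFG' : ∀ x : ℤ, (m : ℤ) ≤ x → ((θ x : ℝ) : ℂ) = G x := by
      intro x hmx
      have : θ x = M⁻¹ * (vonMangoldtW (primorial w) b x.toNat - 1) := by simp [hθ, hmx]
      rw [this]
      simp only [hG, vonMangoldtWSubOne]
      push_cast
      ring
    have hFbd : ∀ x : ℤ, 1 ≤ x → x ≤ N₁ → ‖((θ x : ℝ) : ℂ)‖ ≤ B₀ := by
      intro x hx1 hxN
      by_cases hmx : (m : ℤ) ≤ x
      · rw [hFG' x hmx]; exact hGbd x hx1 hxN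
      · have : θ x = 0 := by simp [hθ, hmx]
        rw [this]; simpa using hB₀0
    have hFG : ∀ x : ℤ, (m : ℤ) < x → x ≤ N₁ → ((θ x : ℝ) : ℂ) = G x := fun x hmx _ => hFG' x hmx.le
    have hpert := norm_uniformityAvg_sub_le (k := s + 1) hN₁k hB₀0 hFbd hGbd hFG
    have hΔ : gowersPerturbConst (s + 1) * B₀ ^ 2 ^ (s + 1) * m / N₁ ≤ (δ / 2) ^ 2 ^ (s + 1) := by
      have h4 := hN₄ N₁ (hN₄H.trans hHN₁)
      have ha0 : 0 ≤ gowersPerturbConst (s + 1) * M⁻¹ ^ 2 ^ (s + 1) *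
          (1 + 2 * Real.log ((N₁ : ℝ) + 1)) ^ 2 ^ (s + 1) :=
        mul_nonneg (mul_nonneg (gowersPerturbConst_pos _).le (by positivity)) (pow_nonneg (by linarith) _)
      calc gowersPerturbConst (s + 1) * B₀ ^ 2 ^ (s + 1) * m / N₁
          = gowersPerturbConst (s + 1) * M⁻¹ ^ 2 ^ (s + 1) *
              (1 + 2 * Real.log ((N₁ : ℝ) + 1)) ^ 2 ^ (s + 1) * m / N₁ := by rw [hB₀, mul_pow]; ring
        _ ≤ gowersPerturbConst (s + 1) * M⁻¹ ^ 2 ^ (s + 1) *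
              (1 + 2 * Real.log ((N₁ : ℝ) + 1)) ^ 2 ^ (s + 1) * ((N₁ : ℝ) ^ ((3 : ℝ) / 5) + 1) / N₁ :=
            div_le_div_of_nonneg_right (mul_le_mul_of_nonneg_left hmle ha0) hN₁r0.le
        _ ≤ (δ / 2) ^ 2 ^ (s + 1) := h4
    have hnorm := uniformityNorm_le_add_rpow (by positivity) (hpert.trans hΔ)
    have hGnorm : uniformityNorm (s + 1) N₁ G =
        M⁻¹ * uniformityNorm (s + 1) N₁ (vonMangoldtWSubOne (primorial w) b) :=
      uniformityNorm_ofReal_mul (s + 1) N₁ (inv_nonneg.mpr hM.le) _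
    have hU'' := hU' N₁ (hN₃H.trans hHN₁) w hw₃ hwN₁ b hb1 hbW hbcop
    have hroot : ((δ / 2) ^ 2 ^ (s + 1)) ^ ((2 : ℝ) ^ (s + 1))⁻¹ = δ / 2 := by
      have h2 : ((2 : ℝ) ^ (s + 1)) = ((2 ^ (s + 1) : ℕ) : ℝ) := by push_cast; ring
      rw [h2, Real.pow_rpow_inv_natCast (by positivity) (by positivity)]
    calc uniformityNorm (s + 1) N₁ (fun n => ((θ n : ℝ) : ℂ))
        ≤ uniformityNorm (s + 1) N₁ G + ((δ / 2) ^ 2 ^ (s + 1)) ^ ((2 : ℝ) ^ (s + 1))⁻¹ := hnorm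
      _ = M⁻¹ * uniformityNorm (s + 1) N₁ (vonMangoldtWSubOne (primorial w) b) + δ / 2 := by
          rw [hGnorm, hroot]
      _ ≤ M⁻¹ * (M * δ / 2) + δ / 2 := by gcongr
      _ = δ := by field_simp; ring
  -- Prop. 7.1 at scale `N₁` for the extended system on the body `K'`
  have hLΨ : affLinSize (extSystem c) N₁ ≤ L := by
    have := affLinSize_extSystem_le c (N₁ : ℝ)
    rw [hLdef]; exact this
  have hKbox : extBody c (m : ℝ) (H : ℝ) ⊆ realBox (s + 2) (N₁ : ℝ) := by
    rw [hN₁r, show (L₀ : ℝ) = (scaleConst c : ℝ) by rw [hL₀def]]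
    exact extBody_subset_realBox hmr1 hHr0.le
  have hvals : ∀ x ∈ extBody c (m : ℝ) (H : ℝ), ∀ i,
      1 ≤ (extSystem c i).realEval x ∧ (extSystem c i).realEval x ≤ N₁ := by
    intro x hx i
    have := realEval_extSystem_mem hmr1 hHr0.le hx i
    rw [hN₁r, show (L₀ : ℝ) = (scaleConst c : ℝ) by rw [hL₀def]]
    exact this
  have hmain := H71' N₁ (hN₁'H.trans hHN₁) p hp hCp hp2 ν (hν.mono (le_max_left D 2) le_rfl) f hfν
    (extSystem c) (isNondegenerateSystem_extSystem hc) (isNormalForm_extSystem hc) hLΨ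
    (extBody c (m : ℝ) (H : ℝ)) (convex_extBody c _ _) hKbox hvals ⟨0, hgowers⟩
  -- evaluate the integrand on the lattice points of `K'`
  obtain ⟨Fθ, hFθ⟩ : ∃ Fθ : ℤ → ℤ → ℝ,
      Fθ = fun nn dd => (vonMangoldtW (primorial w) b dd.toNat - 1) * ∏ j, g j (nn + c j * dd) := ⟨_, rfl⟩
  have hprod : ∀ n ∈ (latticeBox (s + 2) N₁).filter (fun n => realPoint n ∈ extBody c (m : ℝ) (H : ℝ)),
      ∏ i, f i ((extSystem c i).eval n) = (M⁻¹) ^ (s + 2) * Fθ (nVal c n) (dSum n) := by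
    intro n hn
    have hK := (Finset.mem_filter.mp hn).2
    have hK' : realPoint n ∈ extBody c ((m : ℤ) : ℝ) (((H : ℕ) : ℤ) : ℝ) := by exact_mod_cast hK
    obtain ⟨h1, -, h3, -, -⟩ := (realPoint_mem_extBody_iff c m H n).mp hK'
    rw [Fin.prod_univ_succ, hf0, eval_extSystem_zero]
    simp only [hfs, eval_extSystem_succ]
    have hθv : θ (dSum n) = M⁻¹ * (vonMangoldtW (primorial w) b (dSum n).toNat - 1) := by simp [hθ, h1]
    have hgcv : ∀ j, gc j (nVal c n + c j * dSum n) = M⁻¹ * g j (nVal c n + c j * dSum n) := by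
      intro j
      have hge : (m : ℤ) ≤ nVal c n + c j * dSum n := by
        have : 0 ≤ (c j : ℤ) * dSum n := mul_nonneg (by positivity) (by omega)
        omega
      simp [hgc, hge]
    rw [hθv, Finset.prod_congr rfl fun j _ => hgcv j, Finset.prod_mul_distrib, Finset.prod_const,
      Finset.card_univ, Fintype.card_fin, hFθ]
    ring
  have hsumT : ∑ n ∈ (latticeBox (s + 2) N₁).filter (fun n => realPoint n ∈ extBody c (m : ℝ) (H : ℝ)),
      ∏ i, f i ((extSystem c i).eval n) =
      (M⁻¹) ^ (s + 2) * ((H : ℝ) ^ s * ∑ q ∈ Icc (m : ℤ) H ×ˢ Icc (m : ℤ) H, Fθ q.1 q.2) := by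
    rw [Finset.sum_congr rfl hprod, ← Finset.mul_sum]
    congr 1
    have hsc : scaleConst c * H ≤ N₁ := by rw [hN₁, hL₀def]
    exact sum_extBody_eq hm1 hsc Fθ
  -- the cut sum is small
  have hcut : |∑ q ∈ Icc (m : ℤ) H ×ˢ Icc (m : ℤ) H, Fθ q.1 q.2| ≤ ε / 2 * (H : ℝ) ^ 2 := by
    rw [hsumT] at hmain
    rw [abs_mul, abs_mul, abs_of_pos (by positivity : (0 : ℝ) < M⁻¹ ^ (s + 2)),
      abs_of_pos (by positivity : (0 : ℝ) < (H : ℝ) ^ s)] at hmain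
    have hX : (0 : ℝ) < M⁻¹ ^ (s + 2) * (H : ℝ) ^ s := by positivity
    have hid : ε / (2 * M ^ (s + 2) * (L₀ : ℝ) ^ (s + 2)) * ((L₀ : ℝ) * H) ^ (s + 2) =
        (ε / 2 * (H : ℝ) ^ 2) * (M⁻¹ ^ (s + 2) * (H : ℝ) ^ s) := by
      rw [inv_pow, mul_pow]
      field_simp
      ring
    rw [hN₁r, hid] at hmain
    have key : |∑ q ∈ Icc (m : ℤ) H ×ˢ Icc (m : ℤ) H, Fθ q.1 q.2| * (M⁻¹ ^ (s + 2) * (H : ℝ) ^ s) ≤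
        (ε / 2 * (H : ℝ) ^ 2) * (M⁻¹ ^ (s + 2) * (H : ℝ) ^ s) := by
      calc |∑ q ∈ Icc (m : ℤ) H ×ˢ Icc (m : ℤ) H, Fθ q.1 q.2| * (M⁻¹ ^ (s + 2) * (H : ℝ) ^ s)
          = M⁻¹ ^ (s + 2) * ((H : ℝ) ^ s * |∑ q ∈ Icc (m : ℤ) H ×ˢ Icc (m : ℤ) H, Fθ q.1 q.2|) := by ring
        _ ≤ _ := hmain
    exact le_of_mul_le_mul_right key hX
  -- the discarded pairs contribute little
  obtain ⟨B, hB⟩ : ∃ B : ℝ, B = 1 + 2 * Real.log ((N₁ : ℝ) + 1) := ⟨_, rfl⟩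
  have hB0 : 0 ≤ B := by
    rw [hB]; have := Real.log_nonneg (by linarith : (1 : ℝ) ≤ (N₁ : ℝ) + 1); linarith
  have hFbound : ∀ q ∈ Icc (1 : ℤ) H ×ˢ Icc (1 : ℤ) H, |Fθ q.1 q.2| ≤ B := by
    intro q hq
    rw [Finset.mem_product, Finset.mem_Icc, Finset.mem_Icc] at hq
    rw [hFθ, hB]
    dsimp only
    rw [abs_mul]
    have h1 := abs_vonMangoldtW_sub_one_le hWN₁ hbW hq.2.1 (hq.2.2.trans (by exact_mod_cast hHN₁))
    have h2 := abs_prod_le_one_of_bounded hg (fun j => q.1 + c j * q.2)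
    have h0 : 0 ≤ 1 + 2 * Real.log ((N₁ : ℝ) + 1) := by rw [← hB]; exact hB0
    calc |vonMangoldtW (primorial w) b q.2.toNat - 1| * |∏ j, g j (q.1 + c j * q.2)|
        ≤ (1 + 2 * Real.log ((N₁ : ℝ) + 1)) * 1 := mul_le_mul h1 h2 (abs_nonneg _) h0
      _ = _ := mul_one _
  have h5 : 2 * B * ((N₁ : ℝ) ^ ((3 : ℝ) / 5) + 1) ≤ ε / (2 * L₀) * N₁ := by
    have := (div_le_iff₀ hN₁r0).mp (hN₅ N₁ (hN₅H.trans hHN₁))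
    rw [pow_one, ← hB] at this
    exact this
  have hdiff : |∑ q ∈ Icc (1 : ℤ) H ×ˢ Icc (1 : ℤ) H, Fθ q.1 q.2 -
      ∑ q ∈ Icc (m : ℤ) H ×ˢ Icc (m : ℤ) H, Fθ q.1 q.2| ≤ ε / 2 * (H : ℝ) ^ 2 := by
    have hsub : Icc (m : ℤ) H ×ˢ Icc (m : ℤ) H ⊆ Icc (1 : ℤ) H ×ˢ Icc (1 : ℤ) H :=
      Finset.product_subset_product (Finset.Icc_subset_Icc_left (by exact_mod_cast hm1))
        (Finset.Icc_subset_Icc_left (by exact_mod_cast hm1))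
    rw [← Finset.sum_sdiff hsub, add_sub_cancel_right]
    have hcardR : ((((Icc (1 : ℤ) H ×ˢ Icc (1 : ℤ) H) \ (Icc (m : ℤ) H ×ˢ Icc (m : ℤ) H)).card : ℕ) : ℝ) ≤
        2 * m * H := by exact_mod_cast card_sdiff_Icc_prod_le m H
    calc |∑ q ∈ (Icc (1 : ℤ) H ×ˢ Icc (1 : ℤ) H) \ (Icc (m : ℤ) H ×ˢ Icc (m : ℤ) H), Fθ q.1 q.2|
        ≤ ∑ q ∈ (Icc (1 : ℤ) H ×ˢ Icc (1 : ℤ) H) \ (Icc (m : ℤ) H ×ˢ Icc (m : ℤ) H), |Fθ q.1 q.2| :=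
          Finset.abs_sum_le_sum_abs _ _
      _ ≤ ∑ _q ∈ (Icc (1 : ℤ) H ×ˢ Icc (1 : ℤ) H) \ (Icc (m : ℤ) H ×ˢ Icc (m : ℤ) H), B :=
          Finset.sum_le_sum fun q hq => hFbound q (Finset.mem_sdiff.mp hq).1
      _ = ((Icc (1 : ℤ) H ×ˢ Icc (1 : ℤ) H) \ (Icc (m : ℤ) H ×ˢ Icc (m : ℤ) H)).card * B := by
          rw [Finset.sum_const, nsmul_eq_mul]
      _ ≤ (2 * m * H) * B := mul_le_mul_of_nonneg_right hcardR hB0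
      _ = (H : ℝ) * (2 * B * m) := by ring
      _ ≤ (H : ℝ) * (2 * B * ((N₁ : ℝ) ^ ((3 : ℝ) / 5) + 1)) :=
          mul_le_mul_of_nonneg_left (mul_le_mul_of_nonneg_left hmle (by positivity)) hHr0.le
      _ ≤ (H : ℝ) * (ε / (2 * L₀) * N₁) := mul_le_mul_of_nonneg_left h5 hHr0.le
      _ = ε / 2 * (H : ℝ) ^ 2 := by rw [hN₁r]; field_simp
  -- conclusion
  have htri : |∑ q ∈ Icc (1 : ℤ) H ×ˢ Icc (1 : ℤ) H, Fθ q.1 q.2| ≤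
      |∑ q ∈ Icc (1 : ℤ) H ×ˢ Icc (1 : ℤ) H, Fθ q.1 q.2 - ∑ q ∈ Icc (m : ℤ) H ×ˢ Icc (m : ℤ) H, Fθ q.1 q.2| +
        |∑ q ∈ Icc (m : ℤ) H ×ˢ Icc (m : ℤ) H, Fθ q.1 q.2| := by
    have := abs_add_le (∑ q ∈ Icc (1 : ℤ) H ×ˢ Icc (1 : ℤ) H, Fθ q.1 q.2 -
      ∑ q ∈ Icc (m : ℤ) H ×ˢ Icc (m : ℤ) H, Fθ q.1 q.2) (∑ q ∈ Icc (m : ℤ) H ×ˢ Icc (m : ℤ) H, Fθ q.1 q.2)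
    rwa [sub_add_cancel] at this
  calc |∑ q ∈ Icc (1 : ℤ) H ×ˢ Icc (1 : ℤ) H, (vonMangoldtW (primorial w) b q.2.toNat - 1) * ∏ j, g j (q.1 + c j * q.2)|
      = |∑ q ∈ Icc (1 : ℤ) H ×ˢ Icc (1 : ℤ) H, Fθ q.1 q.2| := by rw [hFθ]
    _ ≤ ε / 2 * (H : ℝ) ^ 2 + ε / 2 * (H : ℝ) ^ 2 := htri.trans (add_le_add hdiff hcut)
    _ = ε * (H : ℝ) ^ 2 := by ring

end main



end TaoTeravainen2018

end Literature.NumberTheory.Sieve
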